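import Summits.Schanuel.Schanuel.Theorems.DiophantineDichotomyApproximationPropertyCycleAPThreeDichotomy
import Summits.Schanuel.Schanuel.Theorems.DiophantineDichotomyApproximationPropertySmallPrimeCurveThree
import Summits.Schanuel.Schanuel.Theorems.DiophantineDichotomyApproximationPropertySmallPrimeHypersurface
import Summits.Schanuel.Schanuel.Theorems.DiophantineDichotomyApproximationPropertyCurveHilbertLB
import HarnessLib

/-!
# The clause-free `t = 3` descent with its complete-intersection dichotomy, unconditional (crux `ApproximationProperty`)

Crux `stmt-Schanuel-6117` (`Summit.Schanuel.Schanuel.Theses.DiophantineDichotomy.ApproximationProperty`),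
line `orbit-interpolation-determinant` (lead `prover-line-stmt-Schanuel-6117-c3-0`), registered sub-goal
`cycleAP3_dichotomy`: for every `ω ∈ ℂ³` there is `c ≥ 1` such that for all `Y ≥ Δ ≥ c` the three-cut descent at
`ω̄ = (1 : ω)` yields a small prime surface `(Q)` (`deg Q = a ≤ Δ`), a small prime space curve `𝔮 ⊇ (Q, P)`
(`deg P = b ≤ 2Δ`), a third small form `T ∉ 𝔮` of degree `τ ≤ 4Δ` and a homogeneous PRIME `𝔭 ⊇ 𝔮 + (T)` of rank `1`
(a Galois orbit of points of `ℙ³`) with `deg 𝔭 ≤ (cΔ)³`, `h(𝔭) ≤ cYΔ²`, `log |𝔭(ω̄)| ≤ −(Δ h(𝔭) + Y deg 𝔭)/c`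
— Philippon's clause-free AP1 (`n = 3`, `d' = 0`) — TOGETHER WITH the dichotomy that decides the interpolation clause
of `CycleAPIAt 3` for this orbit:

* either `T` is a non-zero-divisor modulo `(Q, P)`: then `(Q, P, T)` is a complete intersection of dimension `0` and
  the zeros of `𝔭` impose independent conditions on the forms of EVERY degree `s ≥ a + b + τ` (landed `elim_ciSpace`,
  p118633) — the GOOD orbits, transferred to points by `pointDatum_of_clause` (p121904);
* or `T` lies in an associated prime `𝔯 ≠ 𝔮` of `(Q, P)` — another curve component of the cut-2 section `V(Q) ∩ V(P)`
  on which the box principle's third form happens to vanish: the "unlucky cut", where every orbit failing the clause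
  lives (lead c2/c3 analyses, `Cruxes/ApproximationProperty/NOTES.md`).

Composition BY NAME of the landed conditional assembly `cycleAP3_dichotomy_of` (p121934) with `smallPrimeCurve3_of`
(p120742), `small_prime_hypersurface` (p118758) and `curveHilbert_lowerBound` (p120855). Everything is PROVED; no
definitions, no named facts.
-/

set_option linter.dupNamespace false

noncomputable section

namespace Summit.Schanuel.Schanuel.Cruxes.ApproximationProperty.OrbitInterpolationDeterminant

open Literature.NumberTheory.Transcendental Literature.NumberTheory.Transcendental.Nesterenko
open MvPolynomial Real Module

attribute [local instance] MvPolynomial.gradedAlgebra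

/-- **Registered sub-goal `cycleAP3_dichotomy`** — the clause-free `t = 3` descent with the surface `Q`, the curve
`𝔮`, the third form `T` and the orbit `𝔭` exposed, and the dichotomy (clause at every level `≥ a + b + τ`) ∨
(`T` in an associated prime `𝔯 ≠ 𝔮` of `(Q, P)`). Unconditional: `cycleAP3_dichotomy_of` fed with the landed cuts 1–2
and the curve Hilbert lower bound. [cite: NesterenkoPhilippon2001, Ch. 4 §4 (p. 61), AP1 with d' = 0, n = 3] -/
theorem cycleAP3_dichotomy : ∀ ω : Fin 3 → ℂ, ∃ c : ℝ, 1 ≤ c ∧ ∀ Δ Y : ℝ, c ≤ Δ → Δ ≤ Y → ∃ (Q : Rx 3) (a : ℕ) (P : Rx 3) (b : ℕ) (T : Rx 3) (τ : ℕ) (𝔮 𝔭 : Ideal (Rx 3)), Q ≠ 0 ∧ Q.IsHomogeneous a ∧ 1 ≤ a ∧ (a : ℝ) ≤ Δ ∧ (Ideal.span {Q}).IsPrime ∧ P.IsHomogeneous b ∧ 1 ≤ b ∧ (b : ℝ) ≤ 2 * Δ ∧ P ∉ Ideal.span {Q} ∧ T.IsHomogeneous τ ∧ 1 ≤ τ ∧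 (τ : ℝ) ≤ 4 * Δ ∧ T ∉ 𝔮 ∧ 𝔮.IsPrime ∧ 𝔮.IsHomogeneous (homogeneousSubmodule (Fin (3 + 1)) ℚ) ∧ IsUnmixedOfRank 𝔮 2 ∧ Q ∈ 𝔮 ∧ P ∈ 𝔮 ∧ 𝔭.IsPrime ∧ 𝔭.IsHomogeneous (homogeneousSubmodule (Fin (3 + 1)) ℚ) ∧ IsUnmixedOfRank 𝔭 1 ∧ 𝔮 ≤ 𝔭 ∧ T ∈ 𝔭 ∧ (ideg 𝔭 1 : ℝ) ≤ (c * Δ) ^ 3 ∧ iheight 𝔭 1 ≤ c * Y * Δ ^ 2 ∧ iabs 𝔭 1 (Fin.cons 1 ω) ≤ Real.exp (-((Δ * iheight 𝔭 1 + Y * ideg 𝔭 1) / c)) ∧ ((∀ s : ℕ, a + b + τ ≤ s → Module.finrank ℚ ↥(homogeneousSubmodule (Fin (3 + 1)) ℚ s) = Module.finrank ℚ ↥(homogeneousSubmodule (Fin (3 + 1)) ℚ s ⊓ 𝔭.restrictScalars ℚ) + ideg 𝔭 1) ∨ (∃ 𝔯 ∈ associatedPrimes (Rx 3) (Rx 3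 ⧸ (Ideal.span {Q} ⊔ Ideal.span {P})), 𝔯 ≠ 𝔮 ∧ T ∈ 𝔯)) :=
  cycleAP3_dichotomy_of (smallPrimeCurve3_of small_prime_hypersurface) curveHilbert_lowerBound

end Summit.Schanuel.Schanuel.Cruxes.ApproximationProperty.OrbitInterpolationDeterminant

end
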